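import Literature.IUT.LogVolume.Corollary22TwoAdicIntegrality
import Literature.NumberTheory.DiophantineGeometry.GenEllProjLineExamples
import HarnessLib

/-!
# [IUTchIV] Corollary 2.2 (i), first equivalence with a finite exempt set of primes:
# `(1/6)·log(q^{∤S}) ≈ (1/6)·log(q^∀)` on `K_V`, from (∗^{j-inv}) at every `p ∈ S`

S. Mochizuki, *Inter-universal Teichmüller theory IV*, RIMS manuscript (Apr. 2020) = PRIMS **57** (2021),
Cor. 2.2 (i), p. 41 with its proof p. 44: "the equality of BD-classes `(1/6)·log(q^{∤2}) ≈ (1/6)·log(q^∀)`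
follows from condition (∗^{j-inv})" [claim: Mochizuki2012, status: disputed — this equivalence is CLASSICAL
valuation theory; nothing here bears on [IUTchIII] Cor. 3.12]. The tree proves print's case `S = {2}`
(`Cor22.partI_first`, `Corollary22TwoAdicIntegrality.lean`, abc-iut-S-d2). THIS FILE proves the same
bounded-discrepancy statement for an ARBITRARY finite set `S ⊆ supp(K_V)` of exempt primes — the
`Σ`-general form asked for on the cell's gap ledger (row G-lt1-2, `Cor22.partI_avoiding`, consumer: the
`Σ`-exempt reading of [IUTchIV] Thm 1.10 / Cor 2.2, where the `log(q)` of the constructed initial Θ-data is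
`log(q^{∤({2,l} ∪ Σ)})`):

* `Cor22.partI_avoiding` — for a compactly bounded `K_V` (`CBData`), a finite set `S` of primes in the
  support of `K_V`, and the `S`-analogue of (∗^{j-inv}) «for every `p ∈ S` the image of `K_p` under `j` is
  bounded in `ℚ̄_p`», the functions `(1/6)·log(q^{∤S})` and `(1/6)·log(q^∀)` are BD-equivalent on `K_V`.
  PROOF = print's p. 44 argument prime by prime: `‖σ(j(λ))‖_p ≤ C ≤ p^a` for every embedding
  `σ : F → ℚ̄_p` ⟹ `p^a·j(λ)` is integral at every `v ∣ p` (`Cor22.valuation_le_one_of_forall_norm_embedding_le_one`)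
  ⟹ `h_v ≤ a·e_v` ⟹ `Σ_{v ∣ p, bad} h_v·log N(v) ≤ a·[F:ℚ]·log p` (fundamental identity `Σ_{v∣p} e_v f_v = [F:ℚ]`),
  then sum over `p ∈ S`.
* The hypothesis is NEEDED as typed: the tree's `CBData` asks `K_p ∩ X(K)` to be a compact domain for each
  finite `K/ℚ_p` separately (`CBData.Knon_compactDomain`), which does not bound `‖j‖` on `K_p ⊆ ℚ̄_p`; for
  `S = {2}` it is exactly print's (∗^{j-inv}) = `Cor22.JInvBounded` (`Cor22.partI_avoiding_two` recovers
  `Cor22.partI_first`).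
* NON-VACUITY: on abc-iut-S4's standard domains `CBData.std T hT` (`K_p = {‖y − 1/2‖ ≤ ‖p‖}` for every `p`)
  one has `‖j(y)‖ ≤ 1` on `K_p` for EVERY prime `p` (`Cor22.norm_jInv_le_one_of_mem_stdNon`, ultrametric
  bookkeeping), so the hypothesis holds there and `Cor22.partI_avoiding_std` is unconditional.

PROOF-ONLY: no definition, no named fact, no `sorry`; classical height bookkeeping; typed ≠ proved for
anything disputed; nothing here asserts any clause of [IUTchIV] Cor. 2.2 (ii)/(iii) or takes a side on
[IUTchIII] Cor. 3.12.
-/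

noncomputable section

namespace Literature.IUT.LogVolume

namespace Cor22

open NumberField IsDedekindDomain
open Literature.NumberTheory.DiophantineGeometry.GenEll

/-! ## `p`-adic preliminaries -/

/-- `‖p‖ = p⁻¹` in `ℚ̄_p = PadicAlgCl p` (the spectral norm extends the `p`-adic norm).
[cite: Mochizuki2012, IUTchIV Cor 2.2 (i) p.41] -/
theorem norm_natCast_prime_padicAlgCl (p : ℕ) [Fact p.Prime] : ‖(p : PadicAlgCl p)‖ = (p : ℝ)⁻¹ := by
  rw [show (p : PadicAlgCl p) = ((p : ℚ_[p]) : PadicAlgCl p) from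
    (map_natCast (algebraMap ℚ_[p] (PadicAlgCl p)) p).symm, PadicAlgCl.norm_extends, Padic.norm_p]

/-- A real constant is dominated by a power of the prime `p`: `C ≤ p^a` for some `a ∈ ℕ`.
[cite: Mochizuki2012, IUTchIV Cor 2.2 (i) p.41] -/
theorem exists_le_prime_pow (p : ℕ) [Fact p.Prime] (C : ℝ) : ∃ a : ℕ, C ≤ (p : ℝ) ^ a := by
  refine ⟨⌈C⌉₊, (Nat.le_ceil C).trans ?_⟩
  have h2 : (⌈C⌉₊ : ℝ) ≤ (2 : ℝ) ^ ⌈C⌉₊ := by exact_mod_cast Nat.lt_two_pow_self.le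
  refine h2.trans (pow_le_pow_left₀ (by norm_num) ?_ _)
  exact_mod_cast (Fact.out : p.Prime).two_le

variable {D : CBData}

/-! ## (∗^{j-inv}) at a prime `p` made effective -/

/-- **(∗^{j-inv})_p made effective.** If `p` lies in the support of `K_V` and `j(K_p)` is bounded in
`ℚ̄_p`, there is an `a ∈ ℕ` with `‖σ(p^a·j(λ))‖ ≤ 1` for every `P = (F, λ) ∈ K_V` and every embedding
`σ : F → ℚ̄_p` (`σ(λ) ∈ K_p`, `‖j(σ(λ))‖ ≤ C ≤ p^a`). [cite: Mochizuki2012, IUTchIV Cor 2.2 (i) p.41] -/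
theorem exists_norm_embedding_prime_pow_mul_jInv_le_one (p : ℕ) [Fact p.Prime] (hp : p ∈ D.primes)
    (hj : ∃ C : ℝ, ∀ y ∈ D.Knon p, ‖jInv y‖ ≤ C) :
    ∃ a : ℕ, ∀ P ∈ D.toSet, ∀ σ : P.F →+* PadicAlgCl p, ‖σ ((p : P.F) ^ a * jInv P.x)‖ ≤ 1 := by
  obtain ⟨C, hC⟩ := hj
  obtain ⟨a, ha⟩ := exists_le_prime_pow p C
  refine ⟨a, fun P hP σ => ?_⟩
  have hmem : σ P.x ∈ D.Knon p := hP.2 p hp σ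
  have hjb : ‖σ (jInv P.x)‖ ≤ C := by rw [ringHom_map_jInv]; exact hC _ hmem
  have hp0 : (0 : ℝ) < (p : ℝ) ^ a := pow_pos (by exact_mod_cast (Fact.out : p.Prime).pos) a
  rw [map_mul, map_pow, map_natCast, norm_mul, norm_pow, norm_natCast_prime_padicAlgCl, inv_pow,
    inv_mul_le_iff₀ hp0, mul_one]
  exact hjb.trans ha

/-- For `P = (F, λ) ∈ K_V` and `v ∣ p`: `p^a·j(λ)` is `v`-integral (integrality at all `p`-adic
embeddings forces integrality at all places over `p`). [cite: Mochizuki2012, IUTchIV Cor 2.2 (i) p.41] -/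
theorem exists_valuation_prime_pow_mul_jInv_le_one (p : ℕ) [Fact p.Prime] (hp : p ∈ D.primes)
    (hj : ∃ C : ℝ, ∀ y ∈ D.Knon p, ‖jInv y‖ ≤ C) :
    ∃ a : ℕ, ∀ P ∈ D.toSet, ∀ v : HeightOneSpectrum (𝓞 P.F), (p : 𝓞 P.F) ∈ v.asIdeal →
      v.valuation P.F ((p : P.F) ^ a * jInv P.x) ≤ 1 := by
  obtain ⟨a, ha⟩ := exists_norm_embedding_prime_pow_mul_jInv_le_one p hp hj
  exact ⟨a, fun P hP v hv => valuation_le_one_of_forall_norm_embedding_le_one p (ha P hP) v hv⟩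

/-- The local height at `v` is controlled by `a·ord_v(p)` once `p^a·j(λ)` is `v`-integral:
`h_v = max(0, −ord_v(j(λ))) ≤ a·ord_v(p)`. [cite: Mochizuki2012, IUTchIV Cor 2.2 (i) p.41] -/
theorem localHeight_le_of_valuation_prime_pow_mul_le_one (P : NFPoint) (v : HeightOneSpectrum (𝓞 P.F))
    (p : ℕ) (hp0 : p ≠ 0) (a : ℕ) (h : v.valuation P.F ((p : P.F) ^ a * jInv P.x) ≤ 1) :
    localHeight P v ≤ a * (ord P.F v (p : P.F) : ℝ) := by
  have hordp : 0 ≤ ord P.F v (p : P.F) := by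
    have := ord_nonneg_of_isIntegral P.F v (p : 𝓞 P.F)
    rwa [NumberField.RingOfIntegers.coe_eq_algebraMap, map_natCast] at this
  have hbound : ((-(ord P.F v (jInv P.x))).toNat : ℤ) ≤ a * ord P.F v (p : P.F) := by
    by_cases hj : jInv P.x = 0
    · rw [hj, ord_zero, neg_zero, Int.toNat_zero, Nat.cast_zero]
      positivity
    · have hpF : (p : P.F) ^ a ≠ 0 := pow_ne_zero _ (Nat.cast_ne_zero.mpr hp0)
      have hord : 0 ≤ ord P.F v ((p : P.F) ^ a * jInv P.x) :=
        ord_nonneg_of_valuation_le_one v (mul_ne_zero hpF hj) h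
      rw [ord_mul P.F v hpF hj, ord_pow] at hord
      have hle : -(ord P.F v (jInv P.x)) ≤ a * ord P.F v (p : P.F) := by linarith
      rcases le_or_gt 0 (-(ord P.F v (jInv P.x))) with hnn | hneg
      · rwa [Int.toNat_of_nonneg hnn]
      · rw [Int.toNat_eq_zero.mpr hneg.le, Nat.cast_zero]
        positivity
  unfold localHeight
  have := (Int.cast_le (R := ℝ)).mpr hbound
  push_cast at this
  exact_mod_cast this

open scoped Classical in
/-- **The `p`-adic part of `log(q^∀)` is bounded on `K_V`**: under (∗^{j-inv})_p there is `a ∈ ℕ` with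
`Σ_{v ∣ p, bad} h_v·log N(v) ≤ a·[F:ℚ]·log p` for every `P = (F, λ) ∈ K_V` (`h_v ≤ a·e_v` against
`log N(v) = f_v·log p` and `Σ_{v∣p} e_v f_v = [F:ℚ]`). [cite: Mochizuki2012, IUTchIV Cor 2.2 (i) p.41] -/
theorem exists_sum_localHeight_prime_le (p : ℕ) [Fact p.Prime] (hp : p ∈ D.primes)
    (hj : ∃ C : ℝ, ∀ y ∈ D.Knon p, ‖jInv y‖ ≤ C) :
    ∃ a : ℕ, ∀ P ∈ D.toSet,
      ∑ v ∈ (badPlaces P).filter (fun v => (p : 𝓞 P.F) ∈ v.asIdeal),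
        localHeight P v * logNorm P.F v ≤ a * (Module.finrank ℚ P.F * Real.log p) := by
  have hpp : p.Prime := Fact.out
  obtain ⟨a, ha⟩ := exists_valuation_prime_pow_mul_jInv_le_one p hp hj
  refine ⟨a, fun P hP => ?_⟩
  have hterm : ∀ v ∈ (badPlaces P).filter (fun v => (p : 𝓞 P.F) ∈ v.asIdeal),
      localHeight P v * logNorm P.F v ≤ a * Real.log p * localDegree P.F v := by
    intro v hv
    rw [Finset.mem_filter] at hv
    have hvp : v ∈ placesOver P.F p := mem_placesOver_of_natCast_mem p v hv.2
    have hres : residueChar P.F v = p := (mem_placesOver_iff_residueChar v).mp hvp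
    have hord : (ord P.F v (p : P.F) : ℝ) = ramIdx P.F v := by
      exact_mod_cast ord_natCast_eq_ramIdx p v hvp
    have hlh : localHeight P v ≤ a * (ramIdx P.F v : ℝ) := by
      rw [← hord]
      exact localHeight_le_of_valuation_prime_pow_mul_le_one P v p hpp.ne_zero a (ha P hP v hv.2)
    have hln : logNorm P.F v = resDeg P.F v * Real.log p := by rw [logNorm_eq, hres]
    rw [hln, localDegree, Nat.cast_mul]
    have hlogp : 0 ≤ Real.log p := Real.log_natCast_nonneg p
    have hf : (0 : ℝ) ≤ resDeg P.F v * Real.log p := by positivity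
    calc localHeight P v * (resDeg P.F v * Real.log p)
        ≤ a * (ramIdx P.F v : ℝ) * (resDeg P.F v * Real.log p) := mul_le_mul_of_nonneg_right hlh hf
      _ = a * Real.log p * (ramIdx P.F v * resDeg P.F v : ℝ) := by ring
  have hsub : (badPlaces P).filter (fun v => (p : 𝓞 P.F) ∈ v.asIdeal) ⊆ placesOver P.F p :=
    fun v hv => mem_placesOver_of_natCast_mem p v (Finset.mem_filter.mp hv).2
  have hlogp : 0 ≤ Real.log p := Real.log_natCast_nonneg p
  calc ∑ v ∈ (badPlaces P).filter (fun v => (p : 𝓞 P.F) ∈ v.asIdeal), localHeight P v * logNorm P.F v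
      ≤ ∑ v ∈ (badPlaces P).filter (fun v => (p : 𝓞 P.F) ∈ v.asIdeal),
          a * Real.log p * (localDegree P.F v : ℝ) := Finset.sum_le_sum hterm
    _ ≤ ∑ v ∈ placesOver P.F p, a * Real.log p * (localDegree P.F v : ℝ) :=
        Finset.sum_le_sum_of_subset_of_nonneg hsub fun v _ _ => by positivity
    _ = a * Real.log p * ∑ v ∈ placesOver P.F p, (localDegree P.F v : ℝ) := by rw [Finset.mul_sum]
    _ = a * (Module.finrank ℚ P.F * Real.log p) := by rw [← Nat.cast_sum, sum_localDegree]; ring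

/-! ## Summing over the exempt set `S` -/

/-- For nonnegative `f`, a sum over a finite union is at most the sum of the sums. [folklore] -/
private theorem sum_biUnion_le_sum_sum {ι β : Type*} [DecidableEq β] (s : Finset ι) (t : ι → Finset β)
    (f : β → ℝ) (hf : ∀ b, 0 ≤ f b) : ∑ b ∈ s.biUnion t, f b ≤ ∑ i ∈ s, ∑ b ∈ t i, f b := by
  classical
  induction s using Finset.induction_on with
  | empty => simp
  | insert a s ha ih =>
    rw [Finset.biUnion_insert, Finset.sum_insert ha]
    have hui := Finset.sum_union_inter (s₁ := t a) (s₂ := s.biUnion t) (f := f)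
    have hint : 0 ≤ ∑ b ∈ t a ∩ s.biUnion t, f b := Finset.sum_nonneg fun b _ => hf b
    linarith

open scoped Classical in
/-- The `q`-parameter divisor splits as its part away from `S` plus its part at the places over some
`p ∈ S`: `qDivisor P ∅ = qDivisor P S + Σ_{v bad, ∃ p ∈ S, v ∣ p} h_v·[v]`.
[cite: Mochizuki2012, IUTchIV Cor 2.2 (i) p.41] -/
theorem qDivisor_empty_eq_add (P : NFPoint) (S : Finset ℕ) :
    qDivisor P ∅ = qDivisor P S +
      ∑ v ∈ (badPlaces P).filter (fun v => ¬ ∀ p ∈ S, ((p : ℕ) : 𝓞 P.F) ∉ v.asIdeal),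
        FinDivisor.of v (localHeight P v) := by
  unfold qDivisor
  rw [Finset.filter_true_of_mem (fun v _ => by simp),
    ← Finset.sum_filter_add_sum_filter_not (badPlaces P)
      (fun v => ∀ p ∈ S, ((p : ℕ) : 𝓞 P.F) ∉ v.asIdeal)]

open scoped Classical in
/-- The places of `F` that are bad and lie over SOME `p ∈ S` are contained in the union over `p ∈ S` of
the bad places over `p`. [cite: Mochizuki2012, IUTchIV Cor 2.2 (i) p.41] -/
theorem filter_exists_mem_subset_biUnion (P : NFPoint) (S : Finset ℕ) :
    (badPlaces P).filter (fun v => ¬ ∀ p ∈ S, ((p : ℕ) : 𝓞 P.F) ∉ v.asIdeal) ⊆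
      S.biUnion (fun p => (badPlaces P).filter (fun v => ((p : ℕ) : 𝓞 P.F) ∈ v.asIdeal)) := by
  intro v hv
  rw [Finset.mem_filter] at hv
  obtain ⟨hbad, hex⟩ := hv
  push Not at hex
  obtain ⟨p, hpS, hpv⟩ := hex
  rw [Finset.mem_biUnion]
  exact ⟨p, hpS, Finset.mem_filter.mpr ⟨hbad, hpv⟩⟩

open scoped Classical in
/-- **`log(q^∀) ≤ log(q^{∤S}) + Σ_{p ∈ S} a_p·log p` on `K_V`**, for a finite set `S` of primes in the support of
`K_V` at each of which `j(K_p)` is bounded: the two functions differ by the normalised degree of the part of the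
`q`-parameter divisor over `S`, bounded prime by prime by `exists_sum_localHeight_prime_le`.
[cite: Mochizuki2012, IUTchIV Cor 2.2 (i) p.41] -/
theorem exists_logQForall_le_logQAvoid_add (S : Finset ℕ) (hS : D.SupportContains S)
    (hj : ∀ p ∈ S, ∀ [Fact p.Prime], ∃ C : ℝ, ∀ y ∈ D.Knon p, ‖jInv y‖ ≤ C) :
    ∃ B : ℝ, ∀ P ∈ D.toSet, logQForall P ≤ logQAvoid P S + B := by
  have key : ∀ p ∈ S, ∃ a : ℕ, ∀ P ∈ D.toSet,
      ∑ v ∈ (badPlaces P).filter (fun v => (p : 𝓞 P.F) ∈ v.asIdeal),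
        localHeight P v * logNorm P.F v ≤ a * (Module.finrank ℚ P.F * Real.log p) := by
    intro p hpS
    have hpD : p ∈ D.primes := hS hpS
    haveI : Fact p.Prime := ⟨D.primes_prime p hpD⟩
    exact exists_sum_localHeight_prime_le p hpD (hj p hpS)
  choose! a ha using key
  refine ⟨∑ p ∈ S, (a p : ℝ) * Real.log p, fun P hP => ?_⟩
  have hn : (0 : ℝ) < Module.finrank ℚ P.F := FinDivisor.finrank_pos
  have hnonneg : ∀ v : HeightOneSpectrum (𝓞 P.F), 0 ≤ localHeight P v * logNorm P.F v :=
    fun v => mul_nonneg (localHeight_nonneg P v) (logNorm_pos P.F v).le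
  unfold logQForall logQAvoid
  rw [qDivisor_empty_eq_add P S, map_add, add_le_add_iff_left, FinDivisor.ndeg_apply,
    FinDivisor.deg_sum_of, div_le_iff₀ hn]
  calc ∑ v ∈ (badPlaces P).filter (fun v => ¬ ∀ p ∈ S, ((p : ℕ) : 𝓞 P.F) ∉ v.asIdeal),
          localHeight P v * logNorm P.F v
      ≤ ∑ v ∈ S.biUnion (fun p => (badPlaces P).filter (fun v => ((p : ℕ) : 𝓞 P.F) ∈ v.asIdeal)),
          localHeight P v * logNorm P.F v :=
        Finset.sum_le_sum_of_subset_of_nonneg (filter_exists_mem_subset_biUnion P S)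
          fun v _ _ => hnonneg v
    _ ≤ ∑ p ∈ S, ∑ v ∈ (badPlaces P).filter (fun v => ((p : ℕ) : 𝓞 P.F) ∈ v.asIdeal),
          localHeight P v * logNorm P.F v :=
        sum_biUnion_le_sum_sum S _ _ hnonneg
    _ ≤ ∑ p ∈ S, (a p : ℝ) * (Module.finrank ℚ P.F * Real.log p) :=
        Finset.sum_le_sum fun p hp => ha p hp P hP
    _ = (∑ p ∈ S, (a p : ℝ) * Real.log p) * Module.finrank ℚ P.F := by
        rw [Finset.sum_mul]
        exact Finset.sum_congr rfl fun p _ => by ring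

/-! ## The bounded-discrepancy statements -/

/-- **[IUTchIV] Cor. 2.2 (i), first equivalence, `S`-exempt form — PROVED.** For a compactly bounded subset
`K_V ⊆ U_X(ℚ̄)` (`D : CBData`), a finite set `S` of primes contained in the support of `K_V`, and the
`S`-analogue of (∗^{j-inv}) «for every `p ∈ S`, `j(K_p)` is a bounded subset of `ℚ̄_p`», the functions
`log(q^{∤S})/6` and `log(q^∀)/6` on `K_V` have bounded discrepancy. (Gap-ledger row G-lt1-2 of the abc-iut
cell, with the boundedness hypothesis the row omits; for `S = {2}` this is print's statement, cf.
`partI_avoiding_two`.) [cite: Mochizuki2012, IUTchIV Cor 2.2 (i) p.41] -/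
theorem partI_avoiding (D : CBData) (S : Finset ℕ) (hS : D.SupportContains S)
    (hj : ∀ p ∈ S, ∀ [Fact p.Prime], ∃ C : ℝ, ∀ y ∈ D.Knon p, ‖jInv y‖ ≤ C) :
    BDEquiv D.toSet (fun P => logQAvoid P S / 6) (fun P => logQForall P / 6) := by
  obtain ⟨B, hB⟩ := exists_logQForall_le_logQAvoid_add S hS hj
  refine ⟨B / 6, fun P hP => ?_⟩
  have h1 : logQAvoid P S ≤ logQForall P := logQAvoid_anti P (Finset.empty_subset _)
  have h2 := hB P hP
  rw [abs_le]
  constructor <;> linarith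

/-- The same statement in the `1/6·(−)` normalisation of `Cor22.PartI`.
[cite: Mochizuki2012, IUTchIV Cor 2.2 (i) p.41] -/
theorem partI_avoiding' (D : CBData) (S : Finset ℕ) (hS : D.SupportContains S)
    (hj : ∀ p ∈ S, ∀ [Fact p.Prime], ∃ C : ℝ, ∀ y ∈ D.Knon p, ‖jInv y‖ ≤ C) :
    BDEquiv D.toSet (fun P => 1 / 6 * logQAvoid P S) (fun P => 1 / 6 * logQForall P) := by
  obtain ⟨C, hC⟩ := partI_avoiding D S hS hj
  refine ⟨C, fun P hP => ?_⟩
  have h := hC P hP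
  simp only at h ⊢
  rwa [one_div_mul_eq_div, one_div_mul_eq_div]

/-- Adding exempt primes is monotone in the obvious direction and costs a bounded amount: for `S ⊆ T` both in
the support with (∗^{j-inv}) on `T`, `log(q^{∤T})/6 ≈ log(q^{∤S})/6` on `K_V`.
[cite: Mochizuki2012, IUTchIV Cor 2.2 (i) p.41] -/
theorem bdEquiv_logQAvoid_of_subset (D : CBData) {S T : Finset ℕ} (hST : S ⊆ T) (hT : D.SupportContains T)
    (hj : ∀ p ∈ T, ∀ [Fact p.Prime], ∃ C : ℝ, ∀ y ∈ D.Knon p, ‖jInv y‖ ≤ C) :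
    BDEquiv D.toSet (fun P => logQAvoid P T / 6) (fun P => logQAvoid P S / 6) := by
  obtain ⟨B, hB⟩ := exists_logQForall_le_logQAvoid_add T hT hj
  refine ⟨B / 6, fun P hP => ?_⟩
  have h1 : logQAvoid P T ≤ logQAvoid P S := logQAvoid_anti P hST
  have h2 : logQAvoid P S ≤ logQForall P := logQAvoid_anti P (Finset.empty_subset _)
  have h3 := hB P hP
  rw [abs_le]
  constructor <;> linarith

/-- Print's case `S = {2}`: under `Cor22.Hypotheses D` (support ∋ 2 and (∗^{j-inv})) the `S`-exempt statement
specialises to the first conjunct of `Cor22.PartI D` — a second proof of `Cor22.partI_first`.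
[cite: Mochizuki2012, IUTchIV Cor 2.2 (i) p.41] -/
theorem partI_avoiding_two (D : CBData) (hD : Hypotheses D) :
    BDEquiv D.toSet (fun P => 1 / 6 * logQNotTwo P) (fun P => 1 / 6 * logQForall P) := by
  have hj : ∀ p ∈ ({2} : Finset ℕ), ∀ [Fact p.Prime], ∃ C : ℝ, ∀ y ∈ D.Knon p, ‖jInv y‖ ≤ C := by
    intro p hp _
    rw [Finset.mem_singleton] at hp
    subst hp
    exact hD.jinv
  exact partI_avoiding' D {2} hD.supp hj

/-! ## Non-vacuity: the hypothesis holds on the standard domains, at every prime -/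

/-- `‖2⁻¹‖ ≥ 1` in `ℚ̄_p` (`‖2‖ ≤ 1`). [folklore] -/
private theorem one_le_norm_inv_two (p : ℕ) [Fact p.Prime] : 1 ≤ ‖(2 : PadicAlgCl p)⁻¹‖ := by
  have h2 : ‖(2 : PadicAlgCl p)‖ ≤ 1 := by
    rw [show (2 : PadicAlgCl p) = ((2 : ℚ_[p]) : PadicAlgCl p) from
      (map_ofNat (algebraMap ℚ_[p] (PadicAlgCl p)) 2).symm, PadicAlgCl.norm_extends]
    simpa using Padic.norm_int_le_one (p := p) 2
  have h2pos : 0 < ‖(2 : PadicAlgCl p)‖ := norm_pos_iff.mpr (by norm_num)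
  rw [norm_inv]
  exact (one_le_inv₀ h2pos).mpr h2

/-- `‖p‖ < ‖2⁻¹‖` in `ℚ̄_p` (`‖p‖ = 1/p < 1 ≤ ‖2⁻¹‖`). [folklore] -/
private theorem norm_prime_lt_norm_inv_two (p : ℕ) [Fact p.Prime] :
    ‖(p : PadicAlgCl p)‖ < ‖(2 : PadicAlgCl p)⁻¹‖ := by
  rw [norm_natCast_prime_padicAlgCl]
  have hp : (1 : ℝ) < p := by exact_mod_cast (Fact.out : p.Prime).one_lt
  exact (inv_lt_one_of_one_lt₀ hp).trans_le (one_le_norm_inv_two p)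

/-- On the standard bounding domain `K_p = {‖y − 1/2‖ ≤ ‖p‖}` of `CBData.std`: `‖y‖ = ‖2⁻¹‖`
(ultrametric: `‖y − 1/2‖ ≤ ‖p‖ < ‖1/2‖`). [cite: MochizukiGenEll2010, Ex 1.3 (ii) p.5] -/
theorem norm_eq_norm_inv_two_of_mem_stdNon (p : ℕ) [Fact p.Prime] {y : PadicAlgCl p}
    (hy : y ∈ CBData.stdNon p) : ‖y‖ = ‖(2 : PadicAlgCl p)⁻¹‖ := by
  rw [CBData.stdNon, Metric.mem_closedBall, dist_eq_norm] at hy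
  have hlt : ‖y - 2⁻¹‖ < ‖(2 : PadicAlgCl p)⁻¹‖ := hy.trans_lt (norm_prime_lt_norm_inv_two p)
  have := IsUltrametricDist.norm_add_eq_max_of_norm_ne_norm hlt.ne
  rw [sub_add_cancel] at this
  rw [this]
  exact max_eq_right hlt.le

/-- On the same domain: `‖y − 1‖ = ‖2⁻¹‖` (`y − 1 = (y − 1/2) − 1/2`). [cite: MochizukiGenEll2010, Ex 1.3 (ii) p.5] -/
theorem norm_sub_one_eq_norm_inv_two_of_mem_stdNon (p : ℕ) [Fact p.Prime] {y : PadicAlgCl p}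
    (hy : y ∈ CBData.stdNon p) : ‖y - 1‖ = ‖(2 : PadicAlgCl p)⁻¹‖ := by
  rw [CBData.stdNon, Metric.mem_closedBall, dist_eq_norm] at hy
  have hlt : ‖y - 2⁻¹‖ < ‖-(2 : PadicAlgCl p)⁻¹‖ := by
    rw [norm_neg]; exact hy.trans_lt (norm_prime_lt_norm_inv_two p)
  have hhalf : (1 : PadicAlgCl p) = 2⁻¹ + 2⁻¹ := by norm_num
  have hrw : y - 1 = (y - 2⁻¹) + (-(2 : PadicAlgCl p)⁻¹) := by rw [hhalf]; ring
  have := IsUltrametricDist.norm_add_eq_max_of_norm_ne_norm hlt.ne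
  rw [← hrw] at this
  rw [this, max_eq_right hlt.le, norm_neg]

/-- **(∗^{j-inv}) at EVERY prime on the standard domain**: for `y ∈ K_p = {‖y − 1/2‖ ≤ ‖p‖}` one has
`‖j(y)‖ = ‖2‖⁸·‖y² − y + 1‖³/(‖y‖²·‖y − 1‖²) ≤ ‖2‖⁸·c⁶/c⁴ = ‖2‖⁶ ≤ 1` with `c = ‖2⁻¹‖ ≥ 1`
(ultrametric: `‖y² − y + 1‖ ≤ max(c², c, 1) = c²`). [cite: Mochizuki2012, IUTchIV Cor 2.2 p.41] -/
theorem norm_jInv_le_one_of_mem_stdNon (p : ℕ) [Fact p.Prime] {y : PadicAlgCl p}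
    (hy : y ∈ CBData.stdNon p) : ‖jInv y‖ ≤ 1 := by
  set c : ℝ := ‖(2 : PadicAlgCl p)⁻¹‖ with hc
  have hc1 : 1 ≤ c := one_le_norm_inv_two p
  have hc0 : 0 < c := one_pos.trans_le hc1
  have hy0 : ‖y‖ = c := norm_eq_norm_inv_two_of_mem_stdNon p hy
  have hy1 : ‖y - 1‖ = c := norm_sub_one_eq_norm_inv_two_of_mem_stdNon p hy
  have h2c : ‖(2 : PadicAlgCl p)‖ = c⁻¹ := by rw [hc, norm_inv, inv_inv]
  have hnum : ‖y ^ 2 - y + 1‖ ≤ c ^ 2 := by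
    have hyy : ‖y ^ 2 - y‖ ≤ c ^ 2 := by
      rw [sub_eq_add_neg]
      refine (IsUltrametricDist.norm_add_le_max _ _).trans (max_le ?_ ?_)
      · rw [norm_pow, hy0]
      · rw [norm_neg, hy0]; nlinarith
    refine (IsUltrametricDist.norm_add_le_max _ _).trans (max_le hyy ?_)
    rw [norm_one]; nlinarith
  have hden : ‖y ^ 2 * (y - 1) ^ 2‖ = c ^ 4 := by
    rw [norm_mul, norm_pow, norm_pow, hy0, hy1]; ring
  rw [jInv, norm_div, norm_mul, norm_pow, norm_pow, h2c, hden, div_le_one (by positivity)]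
  have h3 : ‖y ^ 2 - y + 1‖ ^ 3 ≤ (c ^ 2) ^ 3 := by gcongr
  have hci : c⁻¹ ≤ 1 := inv_le_one_of_one_le₀ hc1
  have hci0 : 0 ≤ c⁻¹ := by positivity
  have hci8 : c⁻¹ ^ 8 ≤ c⁻¹ ^ 2 := pow_le_pow_of_le_one hci0 hci (by norm_num)
  calc c⁻¹ ^ 8 * ‖y ^ 2 - y + 1‖ ^ 3 ≤ c⁻¹ ^ 2 * (c ^ 2) ^ 3 :=
        mul_le_mul hci8 h3 (by positivity) (by positivity)
    _ = c ^ 4 := by field_simp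

/-- **The `S`-analogue of (∗^{j-inv}) holds for the standard compactly bounded subset** `CBData.std T hT`,
at every prime `p` (its `K_p` is the ball `‖y − 1/2‖ ≤ ‖p‖`). [cite: Mochizuki2012, IUTchIV Cor 2.2 p.41] -/
theorem jInvBoundedAt_std (T : Finset ℕ) (hT : ∀ p ∈ T, p.Prime) (p : ℕ) [Fact p.Prime] :
    ∃ C : ℝ, ∀ y ∈ (CBData.std T hT).Knon p, ‖jInv y‖ ≤ C :=
  ⟨1, fun _ hy => norm_jInv_le_one_of_mem_stdNon p hy⟩

/-- **NON-VACUITY of `partI_avoiding`**: on the standard domain `CBData.std T hT` the `S`-exempt first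
equivalence of Cor. 2.2 (i) holds UNCONDITIONALLY for every `S ⊆ T`.
[cite: Mochizuki2012, IUTchIV Cor 2.2 (i) p.41] -/
theorem partI_avoiding_std (T : Finset ℕ) (hT : ∀ p ∈ T, p.Prime) (S : Finset ℕ) (hS : S ⊆ T) :
    BDEquiv (CBData.std T hT).toSet (fun P => logQAvoid P S / 6) (fun P => logQForall P / 6) :=
  partI_avoiding (CBData.std T hT) S hS fun p _ _ => jInvBoundedAt_std T hT p

end Cor22

end Literature.IUT.LogVolume

end
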